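import Mathlib.NumberTheory.RamificationInertia.Galois
import Mathlib.RingTheory.Invariant.Basic
import Mathlib.RingTheory.DedekindDomain.IntegralClosure
import Literature.NumberTheory.DiophantineGeometry.FunctionFieldStepanovProofs
import Literature.NumberTheory.DiophantineGeometry.FunctionFieldDivisorsAdicProofs
import Literature.NumberTheory.DiophantineGeometry.FunctionFieldZetaLPolynomialProofs
import HarnessLib

/-!
# Places above a place, Hilbert's ramification theory, and the Galois double count
(Stichtenoth §3.1, §3.3, §3.8; Prop. 5.2.8 (c) in Bombieri's twisted form)

Third step toward the discharge of the named fact `hasseWeil` of `FunctionFieldZeta`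
(**Stichtenoth Thm. 5.2.1**, the Hasse–Weil theorem, in Bombieri's proof): the Galois-theoretic
lower-bound mechanism. Source: H. Stichtenoth, *Algebraic Function Fields and Codes*, 2nd ed.
(GTM 254), §3.1 (Def. 3.1.3, Prop. 3.1.7), §3.3 (Cor. 3.3.5, Thm. 3.3.7 and its proof), §3.7–3.8
(Thm. 3.7.1, Def. 3.8.1, Thm. 3.8.2) and §5.2, Prop. 5.2.8 (held copy
`book:stichtenothnd-algebraic-function-fields-codes`); E. Bombieri, Sém. Bourbaki 430 (1973).

Rather than re-developing Hilbert's ramification theory for places, this file builds the **bridge**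
between the places of a finite separable extension `Ω/L` of function fields lying above a place `P`
of `L` and the maximal ideals of the integral closure `B` of the valuation ring `𝒪_P` in `Ω`
(a Dedekind domain), and then imports Mathlib's Hilbert theory (`IsGaloisGroup`,
`Ideal.Quotient.stabilizerHom_surjective`, `Ideal.ncard_primesOver_mul_card_inertia_mul_finrank`):

* `PlaceOver.primeBelow Q`, `PlaceOver.ofPrimeIntegralClosure 𝔔`, **`PlaceOver.placesOverEquiv`**:
  places `Q` of `Ω` above `P` ↔ primes `𝔔 = Q ∩ B` of `B` over `P` (Thm. 3.3.7, proof; `𝒪_Q = B_𝔔`);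
* `PlaceOver.smul_primeBelow`, `mem_stabilizer_primeBelow_iff`: the Galois action corresponds, the
  decomposition group of `𝔔` is the stabiliser of `Q` (Def. 3.8.1);
* `PlaceOver.quotientToResidueField`, `mk_constHom_surjective`, `natCard_quotient_primeBelow_eq(_pow)`:
  `B/𝔔 ⊆ 𝒪_Q/Q`, with equality of cardinalities read off at rational places; `f · deg P = [K':k]`
  (`inertiaDeg_mul_degree_eq`);
* `HilbertCount.ncard_primesOver_mul_natCard_stabilizerHom_eq_mul_inertiaDeg`,
  `PlaceOver.ncard_mul_natCard_fixed_frob_mul_inertiaDeg`, `pow_eq_self_of_fixed_frob`: for a rational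
  place `Q` above `P`, the automorphisms `θ` with `θ(Q) = Q` acting on the constant field `K'` of `Ω`
  as `c ↦ c^N` form a coset of the inertia group when `x ↦ x^N` fixes `𝒪_P/P`, and do not exist
  otherwise (Thm. 3.8.2);
* **`PlaceOver.mul_sum_natCard_fixed_eq_card_mul_pointCount` — the double count**
  `[K' : k] · ∑_θ N_θ = [Ω : L] · N_r(L)`: for `Ω/L` Galois over `k = 𝔽_q` with full constant field
  `K' = 𝔽_{q^R}`, if every place of `Ω` above a place of `L` of degree dividing `r` is `K'`-rational,
  then summing over the `θ ∈ Gal(Ω/L)` that act on `K'` as the `q^r`-Frobenius the numbers `N_θ` of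
  `θ`-invariant rational places gives `[Ω:L]/[K':k] · ∑_{deg P ∣ r} deg P`. This is Prop. 5.2.8 (c)
  (`m · N(L) = ∑ N(E_i)`) in Bombieri's formulation, where `N(E_i)` for the fixed field `E_i` of
  `⟨στ⟩` is the number of `στ`-invariant rational places of `E'`; combined with the twisted Stepanov
  bound (`FunctionFieldStepanovProofs`) for `L = F` and `L = 𝔽_q(t)` it yields the two-sided estimate
  (5.23)/(5.24).

No named facts; definitions are genuine (`def`s with bodies). Mathlib supplies: Dedekind property of
integral closures (`integralClosure.isDedekindDomain`), adic valuations and localisations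
(`HeightOneSpectrum.valuation`, `exists_primeCompl_mul_eq_of_integer`), `IsGaloisGroup.of_isFractionRing`,
the action `MulSemiringAction G (integralClosure R K)`, and finite-field Frobenius
(`FiniteField.frobeniusAlgEquivOfAlgebraic`, `orderOf_frobeniusAlgHom`).

## References

* H. Stichtenoth, *Algebraic Function Fields and Codes*, 2nd ed., GTM 254, Springer 2009:
  Def. 3.1.3, Prop. 3.1.7, Cor. 3.3.5, Thm. 3.3.7, Lemma 3.5.2, Thm. 3.6.3, Thm. 3.7.1, Def. 3.8.1,
  Thm. 3.8.2, Lemma 5.1.9, Prop. 5.2.8. [Stichtenoth2009]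
* E. Bombieri, *Counting points on curves over finite fields (d'après S. A. Stepanov)*,
  Sém. Bourbaki 430 (1973).
* A. Weil, *Sur les courbes algébriques et les variétés qui s'en déduisent*, Hermann 1948. [Weil1948]
-/

noncomputable section

open scoped Classical Pointwise

namespace Literature.NumberTheory.DiophantineGeometry.AlgFunctionField

universe u v w

open IsDedekindDomain

/-! ### A Hilbert-theory count (Mathlib's decomposition and inertia groups) -/

namespace HilbertCount

variable {A B : Type*} [CommRing A] [CommRing B] [Algebra A B]
  (G : Type*) [Group G] [Finite G] [MulSemiringAction G B] [IsGaloisGroup G A B]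

/-- For a group homomorphism `f` out of a finite group and `y` in its range, the fibre over `y` has
as many elements as the kernel. [folklore] -/
theorem natCard_fiber_eq_natCard_ker {H M : Type*} [Group H] [Finite H] [Group M] (f : H →* M)
    {y : M} (hy : y ∈ Set.range f) :
    Nat.card {h : H // f h = y} = Nat.card f.ker := by
  haveI := Fintype.ofFinite H
  rw [Nat.card_eq_fintype_card, Fintype.card_subtype, Nat.card_eq_fintype_card,
    show Fintype.card f.ker = Fintype.card {h : H // f h = 1} from
      Fintype.card_congr (Equiv.subtypeEquivRight fun h => f.mem_ker),
    Fintype.card_subtype]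
  exact MonoidHom.card_fiber_eq_of_mem_range f hy ⟨1, map_one f⟩

/-- **Hilbert-theory count.** Let `G` be a finite group acting on `B` with invariants `A`
(`IsGaloisGroup G A B`, e.g. the Galois group of `Frac B / Frac A` for an integrally closed `A` and
its integral closure `B`), `𝔭` a prime of `A` with perfect residue field and `𝔔` a prime of `B`
above it. For every automorphism `φ` of `B/𝔔` over `A/𝔭`, the number of `θ` in the decomposition
group of `𝔔` inducing `φ`, multiplied by the number of primes above `𝔭` and by the residue degree,
is `|G|`: the decomposition group surjects onto `Aut((B/𝔔)/(A/𝔭))` with kernel the inertia group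
(Mathlib `Ideal.Quotient.stabilizerHom_surjective`, `Ideal.Quotient.ker_stabilizerHom`) and
`#{𝔔 | 𝔭} · |I| · f = |G|` (`Ideal.ncard_primesOver_mul_card_inertia_mul_finrank`).
[cite: Stichtenoth2009, Thm. 3.8.2] -/
theorem ncard_primesOver_mul_natCard_stabilizerHom_eq_mul_inertiaDeg
    (𝔭 : Ideal A) [𝔭.IsMaximal] (𝔔 : Ideal B) [𝔔.IsMaximal] [𝔔.LiesOver 𝔭]
    [Finite (A ⧸ 𝔭)] (φ : (B ⧸ 𝔔) ≃ₐ[A ⧸ 𝔭] (B ⧸ 𝔔)) :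
    (𝔭.primesOver B).ncard *
        Nat.card {θ : MulAction.stabilizer G 𝔔 // Ideal.Quotient.stabilizerHom 𝔔 𝔭 G θ = φ} *
          𝔔.inertiaDeg A = Nat.card G := by
  haveI : Field 𝔭.ResidueField := inferInstance
  haveI : Finite 𝔭.ResidueField := inferInstance
  haveI : PerfectField 𝔭.ResidueField := inferInstance
  have hsurj := Ideal.Quotient.stabilizerHom_surjective G 𝔭 𝔔
  rw [natCard_fiber_eq_natCard_ker _ (hsurj φ), Ideal.Quotient.ker_stabilizerHom,
    show Ideal.inertia (MulAction.stabilizer G 𝔔) 𝔔 =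
      (Ideal.inertia G 𝔔).subgroupOf (MulAction.stabilizer G 𝔔) from
        (AddSubgroup.subgroupOf_inertia _ _).symm,
    Nat.card_congr (Subgroup.subgroupOfEquivOfLe (Ideal.inertia_le_stabilizer (M := G) 𝔔)).toEquiv]
  exact Ideal.ncard_primesOver_mul_card_inertia_mul_finrank (G := G) 𝔭 𝔔

end HilbertCount

namespace PlaceOver

/-! ### Places above `P` and primes of the integral closure of `𝒪_P` (Stichtenoth §3.1–3.3) -/

section Basic

variable {k : Type u} {L : Type v} [Field k] [Field L] [Algebra k L]
variable {Ω : Type w} [Field Ω] [Algebra L Ω]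
variable {P : PlaceOver k L}
variable {K' : Type*} [Field K'] [Algebra K' Ω]

/-- The integral closure `B` of `𝒪_P` in `Ω` lies in every valuation ring of `Ω` above `𝒪_P`
(valuation rings are integrally closed; Stichtenoth Cor. 3.3.5: `O'_P = ∩ O_{P'}`).
[cite: Stichtenoth2009, Cor. 3.3.5] -/
theorem coe_mem_of_mem_integralClosure (Q : PlaceOver K' Ω)
    (hQP : ∀ x : L, algebraMap L Ω x ∈ Q.toValuationSubring ↔ x ∈ P.toValuationSubring)
    (b : integralClosure P.toValuationSubring Ω) : (b : Ω) ∈ Q.toValuationSubring := by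
  have hb : IsIntegral P.toValuationSubring (b : Ω) := b.2
  have hb' : IsIntegral Q.toValuationSubring (b : Ω) :=
    hb.map_of_comp_eq (resHom P Q hQP) (RingHom.id Ω) (by ext x; rfl)
  obtain ⟨y, hy⟩ := (IsIntegralClosure.isIntegral_iff (A := Q.toValuationSubring)).1 hb'
  rw [← hy]
  exact y.2

/-- The inclusion `B → 𝒪_Q` of the integral closure of `𝒪_P` into the valuation ring of a place
above `P`. [folklore] -/
def toValuationSubringHom (Q : PlaceOver K' Ω)
    (hQP : ∀ x : L, algebraMap L Ω x ∈ Q.toValuationSubring ↔ x ∈ P.toValuationSubring) :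
    integralClosure P.toValuationSubring Ω →+* Q.toValuationSubring where
  toFun b := ⟨b, coe_mem_of_mem_integralClosure Q hQP b⟩
  map_one' := rfl
  map_mul' _ _ := rfl
  map_zero' := rfl
  map_add' _ _ := rfl

/-- **The prime `𝔔 = Q ∩ B` of the integral closure `B` of `𝒪_P` below a place `Q` above `P`**
(Stichtenoth §3.3, proof of Thm. 3.3.7: the places above `P` correspond to the maximal ideals of
the integral closure `O'_P` of `O_P`). [cite: Stichtenoth2009, Thm. 3.3.7 (proof)] -/
def primeBelow (Q : PlaceOver K' Ω)
    (hQP : ∀ x : L, algebraMap L Ω x ∈ Q.toValuationSubring ↔ x ∈ P.toValuationSubring) :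
    Ideal (integralClosure P.toValuationSubring Ω) :=
  (IsLocalRing.maximalIdeal Q.toValuationSubring).comap (toValuationSubringHom Q hQP)

/-- Membership in `𝔔 = Q ∩ B`: `b ∈ 𝔔 ↔ v_Q(b) < 1`. [folklore] -/
theorem mem_primeBelow_iff (Q : PlaceOver K' Ω)
    (hQP : ∀ x : L, algebraMap L Ω x ∈ Q.toValuationSubring ↔ x ∈ P.toValuationSubring)
    (b : integralClosure P.toValuationSubring Ω) :
    b ∈ primeBelow Q hQP ↔ Q.valuation b < 1 := by
  rw [primeBelow, Ideal.mem_comap, ValuationSubring.valuation_lt_one_iff]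
  rfl

/-- `primeBelow` only depends on the place. [folklore] -/
theorem primeBelow_congr {Q Q' : PlaceOver K' Ω} (h : Q = Q')
    (hQP : ∀ x : L, algebraMap L Ω x ∈ Q.toValuationSubring ↔ x ∈ P.toValuationSubring)
    (hQP' : ∀ x : L, algebraMap L Ω x ∈ Q'.toValuationSubring ↔ x ∈ P.toValuationSubring) :
    primeBelow Q hQP = primeBelow Q' hQP' := by
  subst h; rfl

/-- `𝔔` is a prime ideal. [folklore] -/
instance isPrime_primeBelow (Q : PlaceOver K' Ω)
    (hQP : ∀ x : L, algebraMap L Ω x ∈ Q.toValuationSubring ↔ x ∈ P.toValuationSubring) :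
    (primeBelow Q hQP).IsPrime :=
  Ideal.comap_isPrime _ _

/-- `𝔔` lies over the maximal ideal of `𝒪_P` (`𝔔 ∩ 𝒪_P = P`). [cite: Stichtenoth2009, Def. 3.1.3] -/
instance liesOver_primeBelow (Q : PlaceOver K' Ω)
    (hQP : ∀ x : L, algebraMap L Ω x ∈ Q.toValuationSubring ↔ x ∈ P.toValuationSubring) :
    (primeBelow Q hQP).LiesOver (IsLocalRing.maximalIdeal P.toValuationSubring) := by
  refine ⟨?_⟩
  ext a
  rw [Ideal.under, Ideal.mem_comap, mem_primeBelow_iff]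
  change a ∈ _ ↔ Q.valuation ((resHom P Q hQP a : Q.toValuationSubring) : Ω) < 1
  rw [← ValuationSubring.valuation_lt_one_iff, IsLocalRing.mem_maximalIdeal,
    IsLocalRing.mem_maximalIdeal, mem_nonunits_iff, mem_nonunits_iff, not_iff_not]
  exact ⟨fun ha => ha.map (resHom P Q hQP), (isLocalHom_resHom P Q hQP).1 a⟩

/-- `𝔔 ≠ 0`. [folklore] -/
theorem primeBelow_ne_bot (Q : PlaceOver K' Ω)
    (hQP : ∀ x : L, algebraMap L Ω x ∈ Q.toValuationSubring ↔ x ∈ P.toValuationSubring) :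
    primeBelow Q hQP ≠ ⊥ :=
  Ideal.ne_bot_of_liesOver_of_ne_bot (IsDiscreteValuationRing.not_a_field P.toValuationSubring) _

/-- An element of `B` outside `𝔔` is a unit of `𝒪_Q`: `v_Q(s) = 1`. [folklore] -/
theorem valuation_eq_one_of_not_mem_primeBelow (Q : PlaceOver K' Ω)
    (hQP : ∀ x : L, algebraMap L Ω x ∈ Q.toValuationSubring ↔ x ∈ P.toValuationSubring)
    {s : integralClosure P.toValuationSubring Ω} (hs : s ∉ primeBelow Q hQP) :
    Q.valuation s = 1 := by
  rw [mem_primeBelow_iff, not_lt] at hs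
  exact le_antisymm ((Q.toValuationSubring.valuation_le_one_iff _).2
    (coe_mem_of_mem_integralClosure Q hQP s)) hs

section Const

variable [Finite K']

/-- Elements of the finite field `K'` are integral over `𝒪_P` (roots of `X^{#K'} - X`). [folklore] -/
theorem isIntegral_algebraMap_of_finite (c : K') :
    IsIntegral P.toValuationSubring (algebraMap K' Ω c) := by
  haveI := Fintype.ofFinite K'
  refine ⟨Polynomial.X ^ Fintype.card K' - Polynomial.X, Polynomial.monic_X_pow_sub ?_, ?_⟩
  · rw [Polynomial.degree_X]; exact_mod_cast Fintype.one_lt_card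
  · simp [← map_pow, FiniteField.pow_card]

/-- **The constants `K' → B`**, `c ↦ c` (constants are integral over `𝒪_P`). [folklore] -/
def constHom : K' →+* integralClosure P.toValuationSubring Ω where
  toFun c := ⟨algebraMap K' Ω c, isIntegral_algebraMap_of_finite c⟩
  map_one' := Subtype.ext (map_one _)
  map_mul' x y := Subtype.ext (map_mul _ x y)
  map_zero' := Subtype.ext (map_zero _)
  map_add' x y := Subtype.ext (map_add _ x y)

/-- Underlying map of `constHom` (definitional). [folklore] -/
@[simp] theorem coe_constHom (c : K') :
    ((constHom (P := P) c : integralClosure P.toValuationSubring Ω) : Ω) = algebraMap K' Ω c := rfl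

end Const

/-- **`B/𝔔 → 𝒪_Q/Q`**, the embedding of residue rings induced by `B ⊆ 𝒪_Q` (`𝔔 = Q ∩ B`).
[cite: Stichtenoth2009, Thm. 3.3.7 (proof)] -/
def quotientToResidueField (Q : PlaceOver K' Ω)
    (hQP : ∀ x : L, algebraMap L Ω x ∈ Q.toValuationSubring ↔ x ∈ P.toValuationSubring) :
    integralClosure P.toValuationSubring Ω ⧸ primeBelow Q hQP →+* Q.residueField :=
  Ideal.Quotient.lift (primeBelow Q hQP)
    ((IsLocalRing.residue Q.toValuationSubring).comp (toValuationSubringHom Q hQP))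
    fun b hb => by
      rw [RingHom.comp_apply, IsLocalRing.residue_eq_zero_iff]
      exact hb

/-- `quotientToResidueField` on residue classes (definitional). [folklore] -/
@[simp] theorem quotientToResidueField_mk (Q : PlaceOver K' Ω)
    (hQP : ∀ x : L, algebraMap L Ω x ∈ Q.toValuationSubring ↔ x ∈ P.toValuationSubring)
    (b : integralClosure P.toValuationSubring Ω) :
    quotientToResidueField Q hQP (Ideal.Quotient.mk _ b) =
      IsLocalRing.residue Q.toValuationSubring (toValuationSubringHom Q hQP b) :=
  rfl

/-- `B/𝔔 → 𝒪_Q/Q` is injective (its kernel is `𝔔/𝔔`). [folklore] -/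
theorem quotientToResidueField_injective (Q : PlaceOver K' Ω)
    (hQP : ∀ x : L, algebraMap L Ω x ∈ Q.toValuationSubring ↔ x ∈ P.toValuationSubring) :
    Function.Injective (quotientToResidueField Q hQP) := by
  rw [RingHom.injective_iff_ker_eq_bot, quotientToResidueField, Ideal.ker_quotient_lift]
  have : RingHom.ker ((IsLocalRing.residue Q.toValuationSubring).comp (toValuationSubringHom Q hQP)) =
      primeBelow Q hQP := by
    ext b
    rw [RingHom.mem_ker, RingHom.comp_apply, IsLocalRing.residue_eq_zero_iff]
    rfl
  rw [this, Ideal.map_quotient_self]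


end Basic

section Dedekind

variable {k : Type u} {L : Type v} [Field k] [Field L] [Algebra k L]
variable {Ω : Type w} [Field Ω] [Algebra L Ω]
variable (P : PlaceOver k L)
variable [FiniteDimensional L Ω] [Algebra.IsSeparable L Ω]

/-- The integral closure of `𝒪_P` in a finite separable extension `Ω/L` is a Dedekind domain
(Stichtenoth Cor. 3.3.5 for holomorphy rings; Mathlib `integralClosure.isDedekindDomain`).
[cite: Stichtenoth2009, Cor. 3.3.5] -/
instance isDedekindDomain_integralClosure :
    IsDedekindDomain (integralClosure P.toValuationSubring Ω) :=
  integralClosure.isDedekindDomain P.toValuationSubring L Ω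

/-- Its fraction field is `Ω`. [folklore] -/
instance isFractionRing_integralClosure :
    IsFractionRing (integralClosure P.toValuationSubring Ω) Ω :=
  IsIntegralClosure.isFractionRing_of_finite_extension P.toValuationSubring L Ω _

/-- It is a finite `𝒪_P`-module (Stichtenoth Cor. 3.3.5: an integral basis exists).
[cite: Stichtenoth2009, Cor. 3.3.5] -/
instance finite_integralClosure :
    Module.Finite P.toValuationSubring (integralClosure P.toValuationSubring Ω) :=
  IsIntegralClosure.finite P.toValuationSubring L Ω _

variable {P}
variable {K' : Type*} [Field K'] [Finite K'] [Algebra K' Ω]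

/-- **The place of `Ω` defined by a nonzero prime `𝔔` of the integral closure `B` of `𝒪_P`**: its
valuation ring is the localisation `B_𝔔 ⊆ Ω` (the valuation ring of the `𝔔`-adic valuation), a
discrete valuation ring of `Ω` containing the finite field `K'`
(Stichtenoth Thm. 3.3.7 (proof): `O_{P_i} ⊇ Ker σ_i`). [cite: Stichtenoth2009, Thm. 3.3.7 (proof)] -/
def ofPrimeIntegralClosure (v : HeightOneSpectrum (integralClosure P.toValuationSubring Ω)) :
    PlaceOver K' Ω where
  toValuationSubring := (v.valuation Ω).valuationSubring
  ne_top := by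
    rw [ne_eq, Valuation.valuationSubring_eq_top_iff, not_not]
    infer_instance
  isDVR := by
    rw [← HeightOneSpectrum.valuationSubringAtPrime_eq_valuationSubring]
    exact IsLocalization.AtPrime.isDiscreteValuationRing_of_dedekind_domain _ v.ne_bot _
  algebraMap_mem := algebraMap_mem_of_finite _

/-- Membership in the valuation ring of `ofPrimeIntegralClosure v`: `z ∈ O ↔ v_𝔔(z) ≤ 1`. [folklore] -/
theorem mem_ofPrimeIntegralClosure_iff (v : HeightOneSpectrum (integralClosure P.toValuationSubring Ω))
    (z : Ω) : z ∈ (ofPrimeIntegralClosure (K' := K') v).toValuationSubring ↔ v.valuation Ω z ≤ 1 :=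
  Iff.rfl

/-- The place `ofPrimeIntegralClosure v` lies above `P` when `𝔔` lies over the maximal ideal of
`𝒪_P`. [cite: Stichtenoth2009, Thm. 3.3.7 (proof)] -/
theorem algebraMap_mem_ofPrimeIntegralClosure_iff
    (v : HeightOneSpectrum (integralClosure P.toValuationSubring Ω))
    [v.asIdeal.LiesOver (IsLocalRing.maximalIdeal P.toValuationSubring)] (x : L) :
    algebraMap L Ω x ∈ (ofPrimeIntegralClosure (K' := K') v).toValuationSubring ↔
      x ∈ P.toValuationSubring := by
  constructor
  · intro hx
    by_contra hxP
    have hx0 : x ≠ 0 := by rintro rfl; exact hxP (zero_mem _)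
    have hinv : x⁻¹ ∈ P.toValuationSubring :=
      (P.toValuationSubring.mem_or_inv_mem x).resolve_left hxP
    have h1 : 1 < P.valuation x :=
      not_le.1 (mt (P.toValuationSubring.valuation_le_one_iff x).1 hxP)
    have h2 : P.valuation x⁻¹ < 1 := (Valuation.one_lt_val_iff _ hx0).1 h1
    have hmax : (⟨x⁻¹, hinv⟩ : P.toValuationSubring) ∈
        IsLocalRing.maximalIdeal P.toValuationSubring :=
      (ValuationSubring.valuation_lt_one_iff _ _).2 h2
    have hmem : algebraMap P.toValuationSubring (integralClosure P.toValuationSubring Ω)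
        ⟨x⁻¹, hinv⟩ ∈ v.asIdeal := by
      rw [← Ideal.mem_comap]
      change _ ∈ v.asIdeal.under _
      rw [← Ideal.LiesOver.over (P := v.asIdeal)
        (p := IsLocalRing.maximalIdeal P.toValuationSubring)]
      exact hmax
    have h3 := (HeightOneSpectrum.valuation_lt_one_iff_mem (K := Ω) v _).2 hmem
    have h4 : ((algebraMap P.toValuationSubring (integralClosure P.toValuationSubring Ω)
        ⟨x⁻¹, hinv⟩ : integralClosure P.toValuationSubring Ω) : Ω) = (algebraMap L Ω x)⁻¹ := by
      rw [← map_inv₀]; rfl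
    have h3' : HeightOneSpectrum.valuation Ω v ((algebraMap L Ω x)⁻¹) < 1 := by
      rw [← h4]; exact h3
    rw [← Valuation.one_lt_val_iff _ ((map_ne_zero _).2 hx0)] at h3'
    exact (not_le.2 h3') hx
  · intro hx
    have : algebraMap L Ω x =
        algebraMap (integralClosure P.toValuationSubring Ω) Ω
          (algebraMap P.toValuationSubring _ ⟨x, hx⟩) := rfl
    rw [mem_ofPrimeIntegralClosure_iff, this]
    exact HeightOneSpectrum.valuation_le_one v _

/-- The prime below the place of a prime is that prime: `(B_𝔔 ∩ Ω-valuation ring) ∩ B = 𝔔`.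
[cite: Stichtenoth2009, Thm. 3.3.7 (proof)] -/
theorem primeBelow_ofPrimeIntegralClosure
    (v : HeightOneSpectrum (integralClosure P.toValuationSubring Ω))
    [v.asIdeal.LiesOver (IsLocalRing.maximalIdeal P.toValuationSubring)] :
    primeBelow (ofPrimeIntegralClosure (K' := K') v)
      (algebraMap_mem_ofPrimeIntegralClosure_iff v) = v.asIdeal := by
  ext b
  rw [mem_primeBelow_iff]
  change ((v.valuation Ω).valuationSubring).valuation (b : Ω) < 1 ↔ _
  rw [← (Valuation.isEquiv_valuation_valuationSubring (v.valuation Ω)).lt_one_iff_lt_one]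
  exact HeightOneSpectrum.valuation_lt_one_iff_mem (K := Ω) v b

/-- The place of the prime below a place `Q` above `P` is `Q`: `O_Q = B_𝔔` (elements of `B_𝔔` are
quotients `n/d` with `d ∉ 𝔔` a unit at `Q`, and distinct places have incomparable rings).
[cite: Stichtenoth2009, Thm. 3.3.7 (proof)] -/
theorem ofPrimeIntegralClosure_primeBelow [IsAlgFunctionField K' Ω] (Q : PlaceOver K' Ω)
    (hQP : ∀ x : L, algebraMap L Ω x ∈ Q.toValuationSubring ↔ x ∈ P.toValuationSubring) :
    ofPrimeIntegralClosure (K' := K') ⟨primeBelow Q hQP, inferInstance, primeBelow_ne_bot Q hQP⟩ = Q := by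
  apply eq_of_le
  intro x hx
  obtain ⟨n, d, hnd⟩ := HeightOneSpectrum.exists_primeCompl_mul_eq_of_integer _ x hx
  have hd : Q.valuation (d : integralClosure P.toValuationSubring Ω) = 1 :=
    valuation_eq_one_of_not_mem_primeBelow Q hQP d.2
  have hd0 : ((d : integralClosure P.toValuationSubring Ω) : Ω) ≠ 0 := by
    intro h
    rw [h, Valuation.map_zero] at hd
    exact zero_ne_one hd
  have hx' : x = (n : Ω) * ((d : integralClosure P.toValuationSubring Ω) : Ω)⁻¹ := by
    rw [eq_mul_inv_iff_mul_eq₀ hd0]; exact hnd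
  rw [hx']
  refine mul_mem (coe_mem_of_mem_integralClosure Q hQP n) ?_
  rw [← Q.toValuationSubring.valuation_le_one_iff, map_inv₀]
  change (Q.valuation _)⁻¹ ≤ 1
  rw [hd, inv_one]

variable (P) in
/-- **Places above `P` ↔ primes of the integral closure of `𝒪_P` lying over `P`**
(Stichtenoth Thm. 3.3.7, proof; Cor. 3.3.5): the place `Q` corresponds to `𝔔 = Q ∩ B`, with inverse
`𝔔 ↦` the place with valuation ring `B_𝔔`. [cite: Stichtenoth2009, Thm. 3.3.7 (proof)] -/
def placesOverEquiv [IsAlgFunctionField K' Ω] :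
    {Q : PlaceOver K' Ω // ∀ x : L, algebraMap L Ω x ∈ Q.toValuationSubring ↔ x ∈ P.toValuationSubring} ≃
      (IsLocalRing.maximalIdeal P.toValuationSubring).primesOver
        (integralClosure P.toValuationSubring Ω) where
  toFun Q := ⟨primeBelow Q.1 Q.2, isPrime_primeBelow Q.1 Q.2, liesOver_primeBelow Q.1 Q.2⟩
  invFun 𝔔 :=
    haveI := 𝔔.2.1
    ⟨ofPrimeIntegralClosure ⟨𝔔.1, 𝔔.2.1, Ideal.ne_bot_of_liesOver_of_ne_bot
        (IsDiscreteValuationRing.not_a_field P.toValuationSubring) _⟩,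
      algebraMap_mem_ofPrimeIntegralClosure_iff _⟩
  left_inv Q := Subtype.ext (ofPrimeIntegralClosure_primeBelow Q.1 Q.2)
  right_inv 𝔔 := by
    haveI := 𝔔.2.1
    exact Subtype.ext (primeBelow_ofPrimeIntegralClosure (K' := K') ⟨𝔔.1, 𝔔.2.1, _⟩)

/-- The prime attached to a place above `P` by `placesOverEquiv` is `Q ∩ B` (definitional). [folklore] -/
theorem coe_placesOverEquiv [IsAlgFunctionField K' Ω]
    (Q : {Q : PlaceOver K' Ω // ∀ x : L, algebraMap L Ω x ∈ Q.toValuationSubring ↔ x ∈ P.toValuationSubring}) :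
    ((placesOverEquiv P Q : (IsLocalRing.maximalIdeal P.toValuationSubring).primesOver
        (integralClosure P.toValuationSubring Ω)) : Ideal _) = primeBelow Q.1 Q.2 :=
  rfl

/-! #### The Galois action: `θ(Q) ↔ θ • 𝔔` -/

section Galois

variable [IsAlgFunctionField K' Ω]

omit [FiniteDimensional L Ω] [Algebra.IsSeparable L Ω] in
/-- An `L`-automorphism maps places above `P` to places above `P`. [cite: Stichtenoth2009, Lemma 3.5.2] -/
theorem forall_algebraMap_mem_comapRingEquiv_iff (θ : Ω ≃ₐ[L] Ω) (Q : PlaceOver K' Ω)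
    (hQP : ∀ x : L, algebraMap L Ω x ∈ Q.toValuationSubring ↔ x ∈ P.toValuationSubring) (x : L) :
    algebraMap L Ω x ∈ (Q.comapRingEquiv (θ : Ω ≃+* Ω)).toValuationSubring ↔
      x ∈ P.toValuationSubring := by
  rw [mem_comapRingEquiv_iff]
  change θ (algebraMap L Ω x) ∈ _ ↔ _
  rw [AlgEquiv.commutes, hQP]

/-- The Galois group of `Ω/L` acts on the integral closure `B` of `𝒪_P` with invariant ring `𝒪_P`
(Mathlib `IsGaloisGroup.of_isFractionRing`). [folklore] -/
instance isGaloisGroup_integralClosure [IsGalois L Ω] :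
    IsGaloisGroup (Ω ≃ₐ[L] Ω) P.toValuationSubring (integralClosure P.toValuationSubring Ω) :=
  IsGaloisGroup.of_isFractionRing _ _ _ L Ω

omit [FiniteDimensional L Ω] [Algebra.IsSeparable L Ω] in
/-- **`θ • (Q ∩ B) = θ(Q) ∩ B`**: the prime below the transported place `θ(Q)` (valuation ring
`θ(𝒪_Q)`, i.e. `Q.comapRingEquiv θ⁻¹`) is the translate of the prime below `Q`.
[cite: Stichtenoth2009, Lemma 3.5.2] -/
theorem smul_primeBelow (θ : Ω ≃ₐ[L] Ω) (Q : PlaceOver K' Ω)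
    (hQP : ∀ x : L, algebraMap L Ω x ∈ Q.toValuationSubring ↔ x ∈ P.toValuationSubring) :
    θ • primeBelow Q hQP =
      primeBelow (Q.comapRingEquiv (θ.symm : Ω ≃+* Ω))
        (forall_algebraMap_mem_comapRingEquiv_iff θ.symm Q hQP) := by
  ext b
  rw [Ideal.mem_pointwise_smul_iff_inv_smul_mem, mem_primeBelow_iff, mem_primeBelow_iff,
    valuation_comapRingEquiv_lt_one_iff]
  rfl

/-- **Decomposition group = stabiliser of the place**: `θ • 𝔔 = 𝔔 ↔ θ(Q) = Q`.
[cite: Stichtenoth2009, Def. 3.8.1 (proof setting)] -/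
theorem smul_primeBelow_eq_iff (θ : Ω ≃ₐ[L] Ω) (Q : PlaceOver K' Ω)
    (hQP : ∀ x : L, algebraMap L Ω x ∈ Q.toValuationSubring ↔ x ∈ P.toValuationSubring) :
    θ • primeBelow Q hQP = primeBelow Q hQP ↔ Q.comapRingEquiv (θ : Ω ≃+* Ω) = Q := by
  rw [smul_primeBelow]
  constructor
  · intro h
    have hinj := (placesOverEquiv (K' := K') P).injective
      (a₁ := ⟨Q.comapRingEquiv (θ.symm : Ω ≃+* Ω), forall_algebraMap_mem_comapRingEquiv_iff θ.symm Q hQP⟩)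
      (a₂ := ⟨Q, hQP⟩) (Subtype.ext h)
    have h2 : Q.comapRingEquiv (θ.symm : Ω ≃+* Ω) = Q := congr_arg Subtype.val hinj
    have h3 := congr_arg (fun R : PlaceOver K' Ω => R.comapRingEquiv (θ : Ω ≃+* Ω)) h2
    simp only [comapRingEquiv_comapRingEquiv] at h3
    rw [← h3]
    apply PlaceOver.ext; ext x
    rw [mem_comapRingEquiv_iff]
    change θ.symm (θ x) ∈ _ ↔ _
    rw [AlgEquiv.symm_apply_apply]
  · intro h
    have h3 := congr_arg (fun R : PlaceOver K' Ω => R.comapRingEquiv (θ.symm : Ω ≃+* Ω)) h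
    simp only [comapRingEquiv_comapRingEquiv] at h3
    have h4 : Q.comapRingEquiv (θ.symm : Ω ≃+* Ω) = Q := by
      rw [← h3]
      apply PlaceOver.ext; ext x
      rw [mem_comapRingEquiv_iff]
      change θ (θ.symm x) ∈ _ ↔ _
      rw [AlgEquiv.apply_symm_apply]
    exact primeBelow_congr h4 _ _

end Galois

/-! #### Residue rings: `B/𝔔 = 𝒪_Q/Q`, constants, cardinalities -/

section Residue

/-- `𝔔 = Q ∩ B` is a maximal ideal (a nonzero prime of a Dedekind domain). [folklore] -/
instance isMaximal_primeBelow (Q : PlaceOver K' Ω)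
    (hQP : ∀ x : L, algebraMap L Ω x ∈ Q.toValuationSubring ↔ x ∈ P.toValuationSubring) :
    (primeBelow Q hQP).IsMaximal :=
  (isPrime_primeBelow Q hQP).isMaximal (primeBelow_ne_bot Q hQP)

variable [IsAlgFunctionField K' Ω]

omit [FiniteDimensional L Ω] [Algebra.IsSeparable L Ω] in
/-- **At a rational place `Q`, every residue class of `B/𝔔` is the class of a constant**
(`K' = 𝒪_Q/Q ⊇ B/𝔔 ⊇ K'`). [cite: Stichtenoth2009, Def. 1.1.14] -/
theorem mk_constHom_surjective (Q : PlaceOver K' Ω)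
    (hQP : ∀ x : L, algebraMap L Ω x ∈ Q.toValuationSubring ↔ x ∈ P.toValuationSubring)
    (hQ : Q.IsRational) :
    Function.Surjective fun c : K' => Ideal.Quotient.mk (primeBelow Q hQP) (constHom c) := by
  intro t
  obtain ⟨b, rfl⟩ := Ideal.Quotient.mk_surjective t
  obtain ⟨c, hc⟩ := hQ.algebraMap_residueField_surjective
    (IsLocalRing.residue Q.toValuationSubring (toValuationSubringHom Q hQP b))
  refine ⟨c, quotientToResidueField_injective Q hQP ?_⟩
  rw [quotientToResidueField_mk, quotientToResidueField_mk, ← hc, PlaceOver.algebraMap_residueField_apply]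
  rfl

omit [FiniteDimensional L Ω] [Algebra.IsSeparable L Ω] in
/-- At a rational place, `K' → B/𝔔` is a bijection; in particular `#(B/𝔔) = #K'`.
[cite: Stichtenoth2009, Def. 1.1.14] -/
theorem natCard_quotient_primeBelow_eq (Q : PlaceOver K' Ω)
    (hQP : ∀ x : L, algebraMap L Ω x ∈ Q.toValuationSubring ↔ x ∈ P.toValuationSubring)
    (hQ : Q.IsRational) :
    Nat.card (integralClosure P.toValuationSubring Ω ⧸ primeBelow Q hQP) = Nat.card K' := by
  refine (Nat.card_eq_of_bijective _ ⟨fun a b hab => ?_, mk_constHom_surjective Q hQP hQ⟩).symm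
  have h := congr_arg (quotientToResidueField Q hQP) hab
  simp only [quotientToResidueField_mk] at h
  exact (algebraMap K' Q.residueField).injective h

omit [Finite K'] [IsAlgFunctionField K' Ω] in
/-- `#(B/𝔔) = #(𝒪_P/P)^{f(𝔔|P)}` for finite residue fields. [folklore] -/
theorem natCard_quotient_primeBelow_eq_pow [Finite P.residueField] (Q : PlaceOver K' Ω)
    (hQP : ∀ x : L, algebraMap L Ω x ∈ Q.toValuationSubring ↔ x ∈ P.toValuationSubring) :
    Nat.card (integralClosure P.toValuationSubring Ω ⧸ primeBelow Q hQP) =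
      Nat.card P.residueField ^
        (primeBelow Q hQP).inertiaDeg P.toValuationSubring := by
  rw [Ideal.inertiaDeg_eq_of_isMaximal (IsLocalRing.maximalIdeal P.toValuationSubring)]
  haveI : Finite (P.toValuationSubring ⧸ IsLocalRing.maximalIdeal P.toValuationSubring) :=
    ‹Finite P.residueField›
  letI : Field (P.toValuationSubring ⧸ IsLocalRing.maximalIdeal P.toValuationSubring) :=
    Ideal.Quotient.field _
  exact Module.natCard_eq_pow_finrank
    (K := P.toValuationSubring ⧸ IsLocalRing.maximalIdeal P.toValuationSubring)

end Residue

/-! #### The twisted Frobenius condition at a rational place -/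

section Frobenius

variable [IsAlgFunctionField K' Ω] [IsGalois L Ω]

omit [IsGalois L Ω] in
/-- **Decomposition group**: `θ` stabilises `𝔔 = Q ∩ B` iff `θ(Q) = Q`. [cite: Stichtenoth2009, Def. 3.8.1] -/
theorem mem_stabilizer_primeBelow_iff (θ : Ω ≃ₐ[L] Ω) (Q : PlaceOver K' Ω)
    (hQP : ∀ x : L, algebraMap L Ω x ∈ Q.toValuationSubring ↔ x ∈ P.toValuationSubring) :
    θ ∈ MulAction.stabilizer (Ω ≃ₐ[L] Ω) (primeBelow Q hQP) ↔
      Q.comapRingEquiv (θ : Ω ≃+* Ω) = Q := by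
  rw [MulAction.mem_stabilizer_iff, smul_primeBelow_eq_iff]

omit [FiniteDimensional L Ω] [Algebra.IsSeparable L Ω] [IsAlgFunctionField K' Ω] [IsGalois L Ω] in
/-- The Galois action on the constants inside `B`: `θ • c = θ(c)`. [folklore] -/
theorem coe_smul_constHom (θ : Ω ≃ₐ[L] Ω) (c : K') :
    ((θ • (constHom (P := P) c) : integralClosure P.toValuationSubring Ω) : Ω) =
      θ (algebraMap K' Ω c) := rfl

omit [FiniteDimensional L Ω] [Algebra.IsSeparable L Ω] [Finite K'] [IsAlgFunctionField K' Ω]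
  [IsGalois L Ω] in
/-- Nonzero constants are units at every place: `v_Q(c) = 1` for `c ≠ 0`. [cite: Stichtenoth2009, Prop. 1.1.5] -/
theorem valuation_algebraMap_eq_one (Q : PlaceOver K' Ω) {c : K'} (hc : c ≠ 0) :
    Q.valuation (algebraMap K' Ω c) = 1 := by
  apply le_antisymm ((Q.toValuationSubring.valuation_le_one_iff _).2 (Q.algebraMap_mem c))
  have h := (Q.toValuationSubring.valuation_le_one_iff _).2 (Q.algebraMap_mem c⁻¹)
  rw [map_inv₀, map_inv₀, inv_le_one₀ ?_] at h
  · exact h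
  · exact (Valuation.pos_iff _).2 ((map_ne_zero _).2 hc)

omit [FiniteDimensional L Ω] [Algebra.IsSeparable L Ω] [IsGalois L Ω] in
/-- **The twisted Frobenius condition, read on `B/𝔔` (⇒)**: if `θ(Q) = Q` and `θ(c) = c^N` for all
constants `c ∈ K'`, and `Q` is rational, then the automorphism of `B/𝔔` induced by `θ` is
`x ↦ x^N` (every class is the class of a constant). [cite: Stichtenoth2009, Thm. 3.8.2 (setting)] -/
theorem coe_stabilizerHom_eq_pow (Q : PlaceOver K' Ω)
    (hQP : ∀ x : L, algebraMap L Ω x ∈ Q.toValuationSubring ↔ x ∈ P.toValuationSubring)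
    (hQ : Q.IsRational) (θ : MulAction.stabilizer (Ω ≃ₐ[L] Ω) (primeBelow Q hQP)) {N : ℕ}
    (hθ : ∀ c : K', (θ : Ω ≃ₐ[L] Ω) (algebraMap K' Ω c) = algebraMap K' Ω (c ^ N)) :
    ⇑(Ideal.Quotient.stabilizerHom (primeBelow Q hQP)
        (IsLocalRing.maximalIdeal P.toValuationSubring) (Ω ≃ₐ[L] Ω) θ) = fun x => x ^ N := by
  funext x
  obtain ⟨c, rfl⟩ := mk_constHom_surjective Q hQP hQ x
  change Ideal.Quotient.stabilizerHom _ _ _ θ (Ideal.Quotient.mk _ (constHom c)) = _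
  rw [Ideal.Quotient.stabilizerHom_apply, ← map_pow]
  congr 1
  apply Subtype.ext
  change (((θ : Ω ≃ₐ[L] Ω) • constHom (P := P) c : integralClosure P.toValuationSubring Ω) : Ω) = _
  rw [coe_smul_constHom, hθ, SubmonoidClass.coe_pow, coe_constHom, map_pow]

omit [FiniteDimensional L Ω] [Algebra.IsSeparable L Ω] [IsAlgFunctionField K' Ω] [IsGalois L Ω] in
/-- **The twisted Frobenius condition, read on `B/𝔔` (⇐)**: conversely, if `K'` is the full
constant field of `Ω` and the automorphism of `B/𝔔` induced by `θ ∈ D(Q)` is `x ↦ x^N`, then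
`θ(c) = c^N` for all constants: `θ(c)` is again a constant (it is algebraic over `K'`), congruent to
`c^N` modulo `Q`, and distinct constants are incongruent. [cite: Stichtenoth2009, Thm. 3.8.2 (setting)] -/
theorem forall_apply_algebraMap_eq_of_coe_stabilizerHom_eq_pow [IsIntegrallyClosedIn K' Ω]
    (Q : PlaceOver K' Ω)
    (hQP : ∀ x : L, algebraMap L Ω x ∈ Q.toValuationSubring ↔ x ∈ P.toValuationSubring)
    (θ : MulAction.stabilizer (Ω ≃ₐ[L] Ω) (primeBelow Q hQP)) {N : ℕ}
    (h : ⇑(Ideal.Quotient.stabilizerHom (primeBelow Q hQP)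
        (IsLocalRing.maximalIdeal P.toValuationSubring) (Ω ≃ₐ[L] Ω) θ) = fun x => x ^ N)
    (c : K') : (θ : Ω ≃ₐ[L] Ω) (algebraMap K' Ω c) = algebraMap K' Ω (c ^ N) := by
  haveI := Fintype.ofFinite K'
  -- `θ c` is a constant `c'`
  have hint : IsIntegral K' ((θ : Ω ≃ₐ[L] Ω) (algebraMap K' Ω c)) := by
    refine ⟨Polynomial.X ^ Fintype.card K' - Polynomial.X, Polynomial.monic_X_pow_sub ?_, ?_⟩
    · rw [Polynomial.degree_X]; exact_mod_cast Fintype.one_lt_card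
    · simp only [Polynomial.eval₂_sub, Polynomial.eval₂_X_pow, Polynomial.eval₂_X]
      rw [← map_pow, ← map_pow, FiniteField.pow_card, sub_self]
  obtain ⟨c', hc'⟩ := IsIntegrallyClosedIn.algebraMap_eq_of_integral hint
  -- congruence modulo `𝔔`
  have hmk := congr_fun h (Ideal.Quotient.mk _ (constHom c))
  rw [Ideal.Quotient.stabilizerHom_apply, ← map_pow, Ideal.Quotient.eq, mem_primeBelow_iff] at hmk
  have hsmul : ((θ.1 • constHom (P := P) c : integralClosure P.toValuationSubring Ω) : Ω) =
      algebraMap K' Ω c' := by rw [hc']; rfl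
  have hval : Q.valuation (algebraMap K' Ω (c' - c ^ N)) < 1 := by
    rw [map_sub, ← hsmul, map_pow, ← coe_constHom (P := P), ← SubmonoidClass.coe_pow]
    exact hmk
  by_contra hne
  have hne' : c' - c ^ N ≠ 0 := by
    intro h0; apply hne; rw [← hc', sub_eq_zero.1 h0]
  rw [valuation_algebraMap_eq_one Q hne'] at hval
  exact lt_irrefl _ hval

/-- **Count at a rational place, the split case.** If `Q` is a rational place above `P`, `K'` the full
constant field of `Ω`, and `N` is a power of `#(𝒪_P/P)`, then
`#{𝔔' | P} · #{θ ∈ Gal(Ω/L) ; θ(Q) = Q, θ|_{K'} = (c ↦ c^N)} · f(Q|P) = [Ω : L]`: the `θ` in question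
form a coset of the inertia group inside the decomposition group (Hilbert theory, Stichtenoth
Thm. 3.8.2 (b),(c); here through Mathlib). [cite: Stichtenoth2009, Thm. 3.8.2] -/
theorem ncard_mul_natCard_fixed_frob_mul_inertiaDeg [IsIntegrallyClosedIn K' Ω] [Finite P.residueField]
    (Q : PlaceOver K' Ω)
    (hQP : ∀ x : L, algebraMap L Ω x ∈ Q.toValuationSubring ↔ x ∈ P.toValuationSubring)
    (hQ : Q.IsRational) {N j : ℕ} (hN : Nat.card P.residueField ^ j = N) :
    ((IsLocalRing.maximalIdeal P.toValuationSubring).primesOver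
        (integralClosure P.toValuationSubring Ω)).ncard *
      Nat.card {θ : Ω ≃ₐ[L] Ω // Q.comapRingEquiv (θ : Ω ≃+* Ω) = Q ∧
        ∀ c : K', θ (algebraMap K' Ω c) = algebraMap K' Ω (c ^ N)} *
      (primeBelow Q hQP).inertiaDeg P.toValuationSubring = Nat.card (Ω ≃ₐ[L] Ω) := by
  haveI : Finite (P.toValuationSubring ⧸ IsLocalRing.maximalIdeal P.toValuationSubring) :=
    ‹Finite P.residueField›
  letI : Fintype (P.toValuationSubring ⧸ IsLocalRing.maximalIdeal P.toValuationSubring) :=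
    Fintype.ofFinite _
  letI : Field (P.toValuationSubring ⧸ IsLocalRing.maximalIdeal P.toValuationSubring) :=
    Ideal.Quotient.field _
  letI : Field (integralClosure P.toValuationSubring Ω ⧸ primeBelow Q hQP) :=
    Ideal.Quotient.field _
  haveI : Module.Finite (P.toValuationSubring ⧸ IsLocalRing.maximalIdeal P.toValuationSubring)
      (integralClosure P.toValuationSubring Ω ⧸ primeBelow Q hQP) := inferInstance
  haveI : Algebra.IsAlgebraic (P.toValuationSubring ⧸ IsLocalRing.maximalIdeal P.toValuationSubring)
      (integralClosure P.toValuationSubring Ω ⧸ primeBelow Q hQP) := Algebra.IsAlgebraic.of_finite _ _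
  -- the Frobenius power as an automorphism of `B/𝔔` over `𝒪_P/P`
  set φ := (FiniteField.frobeniusAlgEquivOfAlgebraic
    (P.toValuationSubring ⧸ IsLocalRing.maximalIdeal P.toValuationSubring)
    (integralClosure P.toValuationSubring Ω ⧸ primeBelow Q hQP)) ^ j with hφ
  have hφN : ⇑φ = fun x => x ^ N := by
    rw [hφ, AlgEquiv.coe_pow, FiniteField.coe_frobeniusAlgEquivOfAlgebraic_iterate, ← hN,
      Fintype.card_eq_nat_card]
    rfl
  rw [← HilbertCount.ncard_primesOver_mul_natCard_stabilizerHom_eq_mul_inertiaDeg (Ω ≃ₐ[L] Ω)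
    (IsLocalRing.maximalIdeal P.toValuationSubring) (primeBelow Q hQP) φ]
  congr 2
  refine Nat.card_congr ?_
  refine
    { toFun := fun θ => ⟨⟨θ.1, (mem_stabilizer_primeBelow_iff θ.1 Q hQP).2 θ.2.1⟩, ?_⟩
      invFun := fun θ => ⟨θ.1.1, (mem_stabilizer_primeBelow_iff θ.1.1 Q hQP).1 θ.1.2, ?_⟩
      left_inv := fun θ => rfl
      right_inv := fun θ => rfl }
  · apply AlgEquiv.ext; intro x
    rw [coe_stabilizerHom_eq_pow Q hQP hQ _ θ.2.2, hφN]
  · have h := congr_arg (fun e : _ ≃ₐ[_] _ => ⇑e) θ.2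
    simp only [hφN] at h
    exact forall_apply_algebraMap_eq_of_coe_stabilizerHom_eq_pow Q hQP θ.1 h

omit [IsGalois L Ω] in
/-- **Count at a rational place, the inert case.** If some `θ` with `θ(Q) = Q` acts on the constants
`K'` as `c ↦ c^N` (`Q` rational above `P`), then `x ↦ x^N` fixes the residue field `𝒪_P/P`
pointwise (the induced automorphism of `B/𝔔 = K'` is `𝒪_P/P`-linear); so when `x^N ≠ x` for
some `x ∈ 𝒪_P/P` no such `θ` exists. [cite: Stichtenoth2009, Thm. 3.8.2] -/
theorem pow_eq_self_of_fixed_frob (Q : PlaceOver K' Ω)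
    (hQP : ∀ x : L, algebraMap L Ω x ∈ Q.toValuationSubring ↔ x ∈ P.toValuationSubring)
    (hQ : Q.IsRational) {N : ℕ} (θ : Ω ≃ₐ[L] Ω) (hfix : Q.comapRingEquiv (θ : Ω ≃+* Ω) = Q)
    (hθ : ∀ c : K', θ (algebraMap K' Ω c) = algebraMap K' Ω (c ^ N))
    (a : P.toValuationSubring ⧸ IsLocalRing.maximalIdeal P.toValuationSubring) : a ^ N = a := by
  set θ' : MulAction.stabilizer (Ω ≃ₐ[L] Ω) (primeBelow Q hQP) :=
    ⟨θ, (mem_stabilizer_primeBelow_iff θ Q hQP).2 hfix⟩ with hθ'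
  have h := coe_stabilizerHom_eq_pow Q hQP hQ θ' hθ
  have h1 := congr_fun h (algebraMap _ (integralClosure P.toValuationSubring Ω ⧸ primeBelow Q hQP) a)
  simp only [AlgEquiv.commutes] at h1
  rw [← map_pow] at h1
  exact (FaithfulSMul.algebraMap_injective _ _ h1).symm

end Frobenius

end Dedekind

/-! ### The double count: `[K':k] · ∑_θ N_θ = [Ω:L] · N_r(L)` (Stichtenoth Prop. 5.2.8 (c), twisted) -/

section Count

variable {k : Type u} {L : Type v} [Field k] [Finite k] [Field L] [Algebra k L] [IsAlgFunctionField k L]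
variable {Ω : Type w} [Field Ω] [Algebra L Ω] [Algebra k Ω] [IsScalarTower k L Ω]
  [FiniteDimensional L Ω] [IsGalois L Ω]
variable {K' : Type*} [Field K'] [Finite K'] [Algebra K' Ω] [Algebra k K'] [IsScalarTower k K' Ω]
  [IsAlgFunctionField K' Ω]

omit [Finite k] [IsGalois L Ω] [Finite K'] [IsAlgFunctionField K' Ω] in
/-- `Q.restrict = P` iff `𝒪_Q ∩ L = 𝒪_P` elementwise. [folklore] -/
theorem restrict_eq_iff (Q : PlaceOver K' Ω) (P : PlaceOver k L) :
    Q.restrict (K := k) (F := L) = P ↔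
      ∀ x : L, algebraMap L Ω x ∈ Q.toValuationSubring ↔ x ∈ P.toValuationSubring := by
  rw [PlaceOver.ext_iff, SetLike.ext_iff]
  rfl

omit [Finite k] in
/-- **The places above `P` are as many as the primes of `B` above `P`.** [cite: Stichtenoth2009, Thm. 3.3.7 (proof)] -/
theorem natCard_restrict_eq (P : PlaceOver k L) :
    Nat.card {Q : PlaceOver K' Ω // Q.restrict (K := k) (F := L) = P} =
      ((IsLocalRing.maximalIdeal P.toValuationSubring).primesOver
        (integralClosure P.toValuationSubring Ω)).ncard := by
  rw [← Nat.card_coe_set_eq]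
  exact Nat.card_congr ((Equiv.subtypeEquivRight fun Q => restrict_eq_iff Q P).trans
    (placesOverEquiv (K' := K') P))

omit [IsGalois L Ω] [Finite K'] [IsScalarTower k L Ω] [FiniteDimensional L Ω] [Algebra L Ω] [Algebra K' Ω]
  [IsScalarTower k K' Ω] [IsAlgFunctionField K' Ω] in
/-- If `x ↦ x^{q^r}` fixes the residue field `𝒪_P/P` pointwise then `deg P ∣ r` (the Frobenius of
`(𝒪_P/P)/k` has order `deg P`). [folklore] -/
theorem degree_dvd_of_forall_pow_eq (P : PlaceOver k L) {r : ℕ}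
    (h : ∀ a : P.residueField, a ^ Nat.card k ^ r = a) : P.degree ∣ r := by
  haveI := Fintype.ofFinite k
  haveI := P.finite_residueField
  have hφ : FiniteField.frobeniusAlgHom k P.residueField ^ r = 1 := by
    apply DFunLike.ext; intro a
    rw [AlgHom.coe_pow, FiniteField.coe_frobeniusAlgHom, pow_iterate, AlgHom.one_apply,
      Fintype.card_eq_nat_card]
    exact h a
  have := orderOf_dvd_of_pow_eq_one hφ
  rwa [FiniteField.orderOf_frobeniusAlgHom] at this

omit [IsScalarTower k L Ω] [Algebra k Ω] [Algebra k K'] [IsScalarTower k K' Ω] in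
/-- **`f(Q|P) · deg P = [K' : k]` for a rational place `Q` above `P`** (`#(B/𝔔) = #K' = q^R` and
`#(B/𝔔) = (q^{deg P})^f`). [cite: Stichtenoth2009, Lemma 5.1.9 / Thm. 3.6.3(g)] -/
theorem inertiaDeg_mul_degree_eq (P : PlaceOver k L) (Q : PlaceOver K' Ω)
    (hQP : ∀ x : L, algebraMap L Ω x ∈ Q.toValuationSubring ↔ x ∈ P.toValuationSubring)
    (hQ : Q.IsRational) {R : ℕ} (hK' : Nat.card K' = Nat.card k ^ R) :
    (primeBelow Q hQP).inertiaDeg P.toValuationSubring * P.degree = R := by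
  haveI := P.finite_residueField
  have h1 := natCard_quotient_primeBelow_eq Q hQP hQ
  rw [natCard_quotient_primeBelow_eq_pow Q hQP, natCard_residueField P, hK', ← pow_mul] at h1
  rw [mul_comm]
  exact Nat.pow_right_injective Finite.one_lt_card h1

variable [IsIntegrallyClosedIn K' Ω]

/-- **The double count** (Bombieri's form of Stichtenoth Prop. 5.2.8 (c)). Let `Ω/L` be a finite
Galois extension of function fields over the finite field `k = 𝔽_q`, with `K' ⊇ k` the full (finite)
constant field of `Ω`, `#K' = q^R`, and let `r ≥ 1` be such that every place of `Ω` above a place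
of `L` of degree dividing `r` is `K'`-rational. For `θ ∈ Gal(Ω/L)` acting on `K'` as `c ↦ c^{q^r}` let
`N_θ` be the number of `K'`-rational places `Q` of `Ω` with `θ(Q) = Q`. Then
`R · ∑_θ N_θ = [Ω : L] · N_r(L)`, where `N_r(L) = ∑_{deg P ∣ r} deg P` (`pointCount`). Proof: count
pairs `(θ, Q)`; for `Q` above `P` with `deg P ∣ r` the `θ` form a coset of the inertia group in the
decomposition group (`ncard_mul_natCard_fixed_frob_mul_inertiaDeg`), for `deg P ∤ r` there are none
(`pow_eq_self_of_fixed_frob`), and `#{Q|P} · e · f = [Ω : L]`, `f · deg P = R`.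
[cite: Stichtenoth2009, Prop. 5.2.8(c)] -/
theorem mul_sum_natCard_fixed_eq_card_mul_pointCount {r R : ℕ} (hr : 0 < r)
    (hK' : Nat.card K' = Nat.card k ^ R)
    (hsplit : ∀ P : PlaceOver k L, P.degree ∣ r →
      ∀ Q : PlaceOver K' Ω, Q.restrict (K := k) (F := L) = P → Q.IsRational) :
    R * ∑ θ : {θ : Ω ≃ₐ[L] Ω // ∀ c : K', θ (algebraMap K' Ω c) = algebraMap K' Ω (c ^ Nat.card k ^ r)},
        Nat.card {Q : PlaceOver K' Ω //
          Q.IsRational ∧ Q.comapRingEquiv ((θ : Ω ≃ₐ[L] Ω) : Ω ≃+* Ω) = Q} =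
      Nat.card (Ω ≃ₐ[L] Ω) * pointCount k L r := by
  -- notation
  set q : ℕ := Nat.card k with hq
  have hq1 : 1 < q := Finite.one_lt_card
  set Rat : Finset (PlaceOver K' Ω) := (finite_setOf_degree_eq (K := K') (F := Ω) 1).toFinset with hRat
  have memRat : ∀ Q : PlaceOver K' Ω, Q ∈ Rat ↔ Q.IsRational := fun Q => by
    rw [hRat, Set.Finite.mem_toFinset]; rfl
  let cond : (Ω ≃ₐ[L] Ω) → Prop := fun θ => ∀ c : K', θ (algebraMap K' Ω c) = algebraMap K' Ω (c ^ q ^ r)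
  let fixed : (Ω ≃ₐ[L] Ω) → PlaceOver K' Ω → Prop := fun θ Q => Q.comapRingEquiv (θ : Ω ≃+* Ω) = Q
  let cnt : PlaceOver K' Ω → ℕ := fun Q => Nat.card {θ : Ω ≃ₐ[L] Ω // fixed θ Q ∧ cond θ}
  -- Step 1: double counting of pairs `(θ, Q)`
  have step1 : ∑ θ : {θ : Ω ≃ₐ[L] Ω // cond θ},
      Nat.card {Q : PlaceOver K' Ω // Q.IsRational ∧ fixed θ.1 Q} = ∑ Q ∈ Rat, cnt Q := by
    have hN : ∀ θ : {θ : Ω ≃ₐ[L] Ω // cond θ},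
        Nat.card {Q : PlaceOver K' Ω // Q.IsRational ∧ fixed θ.1 Q} =
          ∑ Q ∈ Rat, if fixed θ.1 Q then 1 else 0 := by
      intro θ
      rw [← Finset.card_filter, ← Fintype.card_coe, ← Nat.card_eq_fintype_card]
      refine Nat.card_congr (Equiv.subtypeEquivRight fun Q => ?_)
      rw [Finset.mem_filter, memRat]
    have hc : ∀ Q : PlaceOver K' Ω, cnt Q =
        ∑ θ : {θ : Ω ≃ₐ[L] Ω // cond θ}, if fixed θ.1 Q then 1 else 0 := by
      intro Q
      rw [← Finset.card_filter, ← Fintype.card_coe, ← Nat.card_eq_fintype_card]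
      refine Nat.card_congr
        { toFun := fun θ => ⟨⟨θ.1, θ.2.2⟩, Finset.mem_filter.2 ⟨Finset.mem_univ _, θ.2.1⟩⟩
          invFun := fun i => ⟨i.1.1, (Finset.mem_filter.1 i.2).2, i.1.2⟩
          left_inv := fun θ => rfl
          right_inv := fun i => rfl }
    simp_rw [hN, hc]
    exact Finset.sum_comm
  -- Step 2: per place `P` of `L` below
  have hfib : ∀ P : PlaceOver k L,
      R * ∑ Q ∈ Rat.filter (fun Q => Q.restrict (K := k) (F := L) = P), cnt Q =
        Nat.card (Ω ≃ₐ[L] Ω) * (if P.degree ∣ r then P.degree else 0) := by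
    intro P
    haveI := P.finite_residueField
    by_cases hdvd : P.degree ∣ r
    · rw [if_pos hdvd]
      set SP := Rat.filter (fun Q => Q.restrict (K := k) (F := L) = P) with hSP
      -- all places above `P` are rational, so `SP` is the full fibre
      have memSP : ∀ Q : PlaceOver K' Ω, Q ∈ SP ↔ Q.restrict (K := k) (F := L) = P := by
        intro Q
        rw [hSP, Finset.mem_filter, memRat]
        exact ⟨fun h => h.2, fun h => ⟨hsplit P hdvd Q h, h⟩⟩
      have hcardSP : SP.card = ((IsLocalRing.maximalIdeal P.toValuationSubring).primesOver
          (integralClosure P.toValuationSubring Ω)).ncard := by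
        rw [← natCard_restrict_eq (K' := K') P, ← Fintype.card_coe, ← Nat.card_eq_fintype_card]
        exact Nat.card_congr (Equiv.subtypeEquivRight fun Q => memSP Q)
      -- the count at each `Q ∈ SP`
      have hQ : ∀ Q ∈ SP, SP.card * (R * cnt Q) = Nat.card (Ω ≃ₐ[L] Ω) * P.degree := by
        intro Q hQSP
        have hQP := (restrict_eq_iff Q P).1 ((memSP Q).1 hQSP)
        have hQrat : Q.IsRational := hsplit P hdvd Q ((memSP Q).1 hQSP)
        obtain ⟨j, hj⟩ := hdvd
        have hN : Nat.card P.residueField ^ j = q ^ r := by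
          rw [natCard_residueField P, ← pow_mul, ← hj]
        have h1 := ncard_mul_natCard_fixed_frob_mul_inertiaDeg Q hQP hQrat hN
        have h2 := inertiaDeg_mul_degree_eq P Q hQP hQrat hK'
        rw [← hcardSP] at h1
        calc SP.card * (R * cnt Q)
            = SP.card * cnt Q * ((primeBelow Q hQP).inertiaDeg P.toValuationSubring) * P.degree := by
              rw [← h2]; ring
          _ = Nat.card (Ω ≃ₐ[L] Ω) * P.degree := by rw [h1]
      have hpos : 0 < SP.card := by
        rw [Finset.card_pos]
        obtain ⟨Q, hQ⟩ := exists_restrict_eq (K' := K') (F' := Ω) P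
        exact ⟨Q, (memSP Q).2 hQ⟩
      apply Nat.eq_of_mul_eq_mul_left hpos
      rw [Finset.mul_sum, Finset.mul_sum, Finset.sum_congr rfl hQ, Finset.sum_const, smul_eq_mul]
    · rw [if_neg hdvd, mul_zero]
      have h0 : ∀ Q ∈ Rat.filter (fun Q => Q.restrict (K := k) (F := L) = P), cnt Q = 0 := by
        intro Q hQ
        rw [Finset.mem_filter, memRat] at hQ
        have hQP := (restrict_eq_iff Q P).1 hQ.2
        simp only [cnt]
        rw [Nat.card_eq_zero]
        left
        refine ⟨fun θ => hdvd (degree_dvd_of_forall_pow_eq P fun a => ?_)⟩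
        exact pow_eq_self_of_fixed_frob Q hQP hQ.1 θ.1 θ.2.1 θ.2.2 a
      rw [Finset.sum_congr rfl h0, Finset.sum_const_zero, mul_zero]
  -- Step 3: sum over the places below
  have hS : ∀ P : PlaceOver k L, P.degree ∣ r → P ∈ Rat.image (fun Q => Q.restrict (K := k) (F := L)) := by
    intro P hP
    obtain ⟨Q, hQ⟩ := exists_restrict_eq (K' := K') (F' := Ω) P
    exact Finset.mem_image.2 ⟨Q, (memRat Q).2 (hsplit P hP Q hQ), hQ⟩
  have step2 : ∑ Q ∈ Rat, cnt Q = ∑ P ∈ Rat.image (fun Q => Q.restrict (K := k) (F := L)),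
      ∑ Q ∈ Rat.filter (fun Q => Q.restrict (K := k) (F := L) = P), cnt Q :=
    (Finset.sum_fiberwise_of_maps_to (s := Rat) (t := Rat.image (fun Q => Q.restrict (K := k) (F := L)))
      (g := fun Q => Q.restrict (K := k) (F := L)) (f := cnt)
      fun Q hQ => Finset.mem_image_of_mem _ hQ).symm
  rw [step1, step2, Finset.mul_sum, Finset.sum_congr rfl fun P _ => hfib P, ← Finset.mul_sum,
    ← Finset.sum_filter, sum_filter_degree_dvd_eq_pointCount _ hr hS]

end Count

end PlaceOver

end Literature.NumberTheory.DiophantineGeometry.AlgFunctionField
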